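import Summits.Ventures.PackingBounds.Energy.FivePointCkTwoOptimal
import Summits.Ventures.PackingBounds.Energy.FivePointCubicOptimal
import Summits.Ventures.PackingBounds.Energy.FivePointQuarticOptimal
import Summits.Ventures.PackingBounds.Configurations.NoUniversalOptimumFive
import HarnessLib

/-!
# Five points on `S²`, potentials `(1+⟪x,y⟫)^k`: the triangular bipyramid for every `k ≤ 4`, and not for `k = 7`

Framing: lottery ticket; floor = certified bounds/negative ranges. Venture `PackingBounds`, cell
`pub-packcert`, energy family E3PT (pub-packcert-energy gen 16; assembly file, the five-point companion of
`TenPointCkAllK`).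

For five unit vectors of `ℝ³` and the potential `(1+t)^k` the triangular bipyramid (inner products `-1` once, `0` six
times, `-1/2` three times among unordered pairs) has energy `12 + 6·(1/2)^k` (ordered pairs; `k ≥ 1`).
This file assembles: the least value IS `12 + 6·(1/2)^k` for every `1 ≤ k ≤ 4` — `k = 1` by `‖Σ x‖² ≥ 0`
(`Config.ckPow_one_energy_eq`), `k = 2, 3, 4` by the kernel-checked exact sharp three-point certificates
`FivePointCkTwo.ck2_five_points` (27/2), `FivePointCubic.ck3_five_points` (51/4), `FivePointQuartic.ck4_five_points` (99/8) —
and it is NOT the least value for `k = 7` (Cohn–Kumar 2007, §1: a square pyramid does better; kernel inequality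
`Config.SquarePyramid.ckPow7_energy_lt`). The cases `k = 5, 6` are open: the bipyramid is the numerical minimiser, but no
three-point certificate of SDP degree ≤ 8 (resp. ≤ 6) proves it (exact moment-side certificates of the cell, E3PT.md §2n(ii)).
-/

noncomputable section

open Finset
open scoped RealInnerProductSpace

namespace Summit.Ventures.PackingBounds.Energy.FivePointCkAll

open Summit.Ventures.PackingBounds.Config Summit.Ventures.PackingBounds.Energy

/-- The bipyramid attains `bipyramidValue k` for every `k ≥ 1` (`0^k = 0` for the antipodal pair). -/
theorem bipyramid_attain (k : ℕ) (hk : 1 ≤ k) :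
    (12 + 6 * (1 / 2 : ℝ) ^ k) ∈ {E : ℝ | ∃ C : Finset (EuclideanSpace ℝ (Fin 3)), C.card = 5 ∧ (∀ x ∈ C, ‖x‖ = 1) ∧
      E = ∑ x ∈ C, ∑ y ∈ C.erase x, (1 + inner ℝ x y) ^ k} := by
  refine ⟨Bipyramid.pts, Bipyramid.card_pts, Bipyramid.norm_pts, ?_⟩
  rw [Bipyramid.energy_pts (fun t : ℝ => (1 + t) ^ k)]
  have hk0 : k ≠ 0 := by omega
  simp only [add_neg_cancel, zero_pow hk0, add_zero, one_pow]
  ring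

/-- **k = 1 (folklore, two-point):** `Σ_{x≠y} (1+⟪x,y⟫) = 15 + ‖Σ x‖² ≥ 15` for five unit vectors of `ℝ³`. -/
theorem ck1_five_points (C : Finset (EuclideanSpace ℝ (Fin 3))) (hC : ∀ x ∈ C, ‖x‖ = 1) (h5 : C.card = 5) :
    (15 : ℝ) ≤ ∑ x ∈ C, ∑ y ∈ C.erase x, (1 + inner ℝ x y) ^ 1 := by
  rw [ckPow_one_energy_eq C hC, h5]
  have := sq_nonneg ‖∑ x ∈ C, x‖
  push_cast
  nlinarith

/-- **Lower bound, `1 ≤ k ≤ 4`:** every five unit vectors of `ℝ³` have `(1+t)^k`-energy `≥ bipyramidValue k`. -/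
theorem ck_five_points (k : ℕ) (hk1 : 1 ≤ k) (hk4 : k ≤ 4) (C : Finset (EuclideanSpace ℝ (Fin 3)))
    (hC : ∀ x ∈ C, ‖x‖ = 1) (h5 : C.card = 5) :
    12 + 6 * (1 / 2 : ℝ) ^ k ≤ ∑ x ∈ C, ∑ y ∈ C.erase x, (1 + inner ℝ x y) ^ k := by
  interval_cases k
  · have h := ck1_five_points C hC h5; norm_num at h ⊢; exact h
  · have h := FivePointCkTwo.ck2_five_points C hC h5; norm_num at h ⊢; exact h
  · have h := FivePointCubic.ck3_five_points C hC h5; norm_num at h ⊢; exact h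
  · have h := FivePointQuartic.ck4_five_points C hC h5; norm_num at h ⊢; exact h

/-- **Five points on `S²`, `(1+⟪x,y⟫)^k` for every `1 ≤ k ≤ 4`, two-sided:** the least energy is the triangular bipyramid's
`12 + 6·(1/2)^k` (`15, 27/2, 51/4, 99/8`). -/
theorem ck_five_points_isLeast (k : ℕ) (hk1 : 1 ≤ k) (hk4 : k ≤ 4) :
    IsLeast {E : ℝ | ∃ C : Finset (EuclideanSpace ℝ (Fin 3)), C.card = 5 ∧ (∀ x ∈ C, ‖x‖ = 1) ∧
      E = ∑ x ∈ C, ∑ y ∈ C.erase x, (1 + inner ℝ x y) ^ k} (12 + 6 * (1 / 2 : ℝ) ^ k) := by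
  refine ⟨bipyramid_attain k hk1, ?_⟩
  rintro E ⟨C, h5, hC, rfl⟩
  exact ck_five_points k hk1 hk4 C hC h5

/-- **`k = 7`: the bipyramid is NOT optimal** (Cohn–Kumar 2007, §1): Cohn–Kumar's square pyramid (`Config.SquarePyramid.pts`,
apex–base inner product `-4/25`) has strictly smaller `(1+t)^7`-energy, so `12 + 6/2^7` is not the least value. -/
theorem bipyramid_not_isLeast_seven :
    ¬ IsLeast {E : ℝ | ∃ C : Finset (EuclideanSpace ℝ (Fin 3)), C.card = 5 ∧ (∀ x ∈ C, ‖x‖ = 1) ∧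
      E = ∑ x ∈ C, ∑ y ∈ C.erase x, (1 + inner ℝ x y) ^ 7} (12 + 6 * (1 / 2 : ℝ) ^ 7) := by
  intro h
  have hmem : (∑ x ∈ SquarePyramid.pts, ∑ y ∈ SquarePyramid.pts.erase x, (1 + inner ℝ x y) ^ 7) ∈
      {E : ℝ | ∃ C : Finset (EuclideanSpace ℝ (Fin 3)), C.card = 5 ∧ (∀ x ∈ C, ‖x‖ = 1) ∧
      E = ∑ x ∈ C, ∑ y ∈ C.erase x, (1 + inner ℝ x y) ^ 7} :=
    ⟨SquarePyramid.pts, SquarePyramid.card_pts, SquarePyramid.norm_pts, rfl⟩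
  have hle := h.2 hmem
  have hlt := SquarePyramid.ckPow7_energy_lt
  have hv : (2 * (1 + (-1 : ℝ)) ^ 7 + 12 * (1 + (0 : ℝ)) ^ 7 + 6 * (1 + (-1 / 2 : ℝ)) ^ 7) = 12 + 6 * (1 / 2 : ℝ) ^ 7 := by
    norm_num
  rw [hv] at hlt
  exact absurd hle (not_le.mpr hlt)

/-- For `k = 7` some five-point configuration does strictly better than the bipyramid (explicit: the square pyramid). -/
theorem exists_lt_bipyramid_seven :
    ∃ E ∈ {E : ℝ | ∃ C : Finset (EuclideanSpace ℝ (Fin 3)), C.card = 5 ∧ (∀ x ∈ C, ‖x‖ = 1) ∧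
      E = ∑ x ∈ C, ∑ y ∈ C.erase x, (1 + inner ℝ x y) ^ 7}, E < (12 + 6 * (1 / 2 : ℝ) ^ 7) := by
  refine ⟨_, ⟨SquarePyramid.pts, SquarePyramid.card_pts, SquarePyramid.norm_pts, rfl⟩, ?_⟩
  have hlt := SquarePyramid.ckPow7_energy_lt
  have hv : (2 * (1 + (-1 : ℝ)) ^ 7 + 12 * (1 + (0 : ℝ)) ^ 7 + 6 * (1 + (-1 / 2 : ℝ)) ^ 7) = 12 + 6 * (1 / 2 : ℝ) ^ 7 := by
    norm_num
  rw [hv] at hlt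
  exact hlt

end Summit.Ventures.PackingBounds.Energy.FivePointCkAll
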